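import Summits.RiemannHypothesis.RiemannHypothesis.Theorems.ScrewLemmaKExtremalRayOperatorBound
import Summits.RiemannHypothesis.RiemannHypothesis.Theorems.ScrewLemmaKExtremalRayMoments
import Summits.RiemannHypothesis.RiemannHypothesis.Theorems.ScrewLemmaKExtremalRayGramRay
import Summits.RiemannHypothesis.RiemannHypothesis.Theorems.ScrewLemmaKExtremalRayMoebius
import HarnessLib

/-!
# Route `ScrewLemmaKExtremalRay`, crux E1 (`NearExtremalGenerators`, stmt-RiemannHypothesis-22262):
# polynomial `L²`-approximants of the Möbius generator with the two admissibility moments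

For the Möbius generator `φ*` (`moebiusRay`; `A φ* = r` on `(0,1]` with `r = gramRay` the extremal
Gram ray of K3 and `A = coprofileOp` the dilation operator) and every `δ > 0` there is a polynomial
`p` with

  `∫₀¹ (p − φ*)² ≤ δ`,   `∫₀¹ p(u)·u du = 0`,   `∫₀¹ p(u)·u^{1/2} du = 0`

(`exists_polynomial_near_moebiusRay`, piece (b) of the E1 split agreed on the cell board).  The
two moments are exactly the conditions `∫g = 0`, `∫ g u^{-1/2} = 0` for the generator
`g = −∫_u^1 p` (tree `ScrewLemmaKCoprofile.integral_deriv_mul_rpow_eq`), so the E1 closer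
integrates `p` to an ADMISSIBLE polynomial generator whose co-profile `A p = r + A(p − φ*)` is
`L²`-close to `r` (`∫(A(p − φ*))² ≤ 9 ∫(p − φ*)²`, `ScrewLemmaKExtremalRayOperatorBound`).

Proof.  (1) `φ* ∈ L²(0,1)` (`memLp_two_moebiusRay`) is `L²`-approximated by a bounded continuous
function (Mathlib `MemLp.exists_boundedContinuous_integral_rpow_sub_le`) and that by a polynomial
`q` (Weierstrass, `exists_polynomial_near_of_continuousOn`).  (2) MOMENT DEFECT: `Re ζ(a+2)·∫₀¹ q u^a
= ∫₀¹ (A q) t^a` (`coprofileOp_polynomial_moment`) and `A q = r + A(q − φ*)` with `r ⊥ √t, t`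
(`setIntegral_gramRay_mul_sqrt/_mul_id`), so `|Re ζ(a+2)|·|∫ q u^a| ≤ 3‖q − φ*‖₂` for `a = 1/2, 1`
(Cauchy–Schwarz + the operator bound).  (3) Subtract `c₀ + c₁u` solving the `2 × 2` Gram system of
`{1, u}` against `{u, √u}` (matrix `[[1/2,1/3],[2/3,2/5]]`, determinant `−1/45`); the correction is
`O(‖q − φ*‖₂)` in `L²`.  RH-free real analysis; nothing here bears on the truth of RH.
-/

set_option linter.dupNamespace false

noncomputable section

namespace Summit.RiemannHypothesis.RiemannHypothesis.Theorems.ScrewLemmaKExtremalRay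

open MeasureTheory Set Filter Polynomial

/-! ### §1 `φ*` bookkeeping -/

/-- `φ*` has integrable square on `(0,1)`. [folklore] -/
theorem integrableOn_sq_moebiusRay :
    IntegrableOn (fun u => moebiusRay u ^ 2) (Set.Ioo (0:ℝ) 1) :=
  (memLp_two_iff_integrable_sq measurable_moebiusRay.aestronglyMeasurable).mp memLp_two_moebiusRay

/-- `(q − φ*)² ∈ L¹(0,1)` for a polynomial `q`. [folklore] -/
theorem integrableOn_sq_polynomial_sub_moebiusRay (q : ℝ[X]) :
    IntegrableOn (fun u => (q.eval u - moebiusRay u) ^ 2) (Set.Ioo (0:ℝ) 1) := by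
  have h1 : MemLp (fun u => q.eval u) 2 (volume.restrict (Set.Ioo (0:ℝ) 1)) :=
    (memLp_two_iff_integrable_sq q.continuous.measurable.aestronglyMeasurable).mpr
      (integrableOn_sq_polynomial q)
  have h2 := h1.sub memLp_two_moebiusRay
  exact (memLp_two_iff_integrable_sq
    (q.continuous.measurable.sub measurable_moebiusRay).aestronglyMeasurable).mp h2

/-! ### §2 The moment defect of a polynomial close to `φ*` -/

/-- MOMENT DEFECT: for a polynomial `q` and `a ≥ 0` with `r ⊥ t^a` on `(0,1)`,
`|Re ζ(a+2)| · |∫₀¹ q u^a| ≤ 3 √(∫₀¹ (q − φ*)²)`.  [folklore] -/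
theorem abs_moment_le_of_gramRay_orth (q : ℝ[X]) {a : ℝ} (ha : 0 ≤ a)
    (hr : ∫ t in Set.Ioo (0:ℝ) 1, gramRay t * t ^ a = 0) :
    |(riemannZeta ((a : ℂ) + 2)).re| * |∫ u in (0:ℝ)..1, q.eval u * u ^ a|
      ≤ 3 * Real.sqrt (∫ u in Set.Ioo (0:ℝ) 1, (q.eval u - moebiusRay u) ^ 2) := by
  have hmom := coprofileOp_polynomial_moment q ha
  -- `A q = r + A(q − φ*)` on `(0,1)`
  set D : ℝ → ℝ := fun u => q.eval u - moebiusRay u with hD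
  have hDm : Measurable D := q.continuous.measurable.sub measurable_moebiusRay
  have hsplit : ∀ t ∈ Set.Ioo (0:ℝ) 1,
      coprofileOp (fun u => q.eval u) t = gramRay t + coprofileOp D t := by
    intro t ht
    have e : (fun u => q.eval u) = fun u => moebiusRay u + D u := by
      funext u; simp [hD]
    rw [e, coprofileOp_add, coprofileOp_moebiusRay ⟨ht.1, ht.2.le⟩]
  have hADint : IntegrableOn (fun t => coprofileOp D t ^ 2) (Set.Ioo (0:ℝ) 1) :=
    integrableOn_coprofileOp_sq hDm (integrableOn_sq_polynomial_sub_moebiusRay q)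
  have hAD9 : (∫ t in Set.Ioo (0:ℝ) 1, coprofileOp D t ^ 2)
      ≤ 9 * ∫ u in Set.Ioo (0:ℝ) 1, D u ^ 2 :=
    integral_coprofileOp_sq_le hDm (integrableOn_sq_polynomial_sub_moebiusRay q)
  -- the weight `t^a` on `(0,1)`: measurable, `0 ≤ t^a ≤ 1`
  have hwm : Measurable fun t : ℝ => t ^ a := (Real.continuous_rpow_const ha).measurable
  have hw01 : ∀ t ∈ Set.Ioo (0:ℝ) 1, 0 ≤ t ^ a ∧ t ^ a ≤ 1 := fun t ht =>
    ⟨Real.rpow_nonneg ht.1.le a, Real.rpow_le_one ht.1.le ht.2.le ha⟩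
  have hw2 : IntegrableOn (fun t : ℝ => (t ^ a) ^ 2) (Set.Ioo (0:ℝ) 1) :=
    integrableOn_sq_of_bound hwm (C := 1) fun t ht => by
      rw [abs_of_nonneg (hw01 t ht).1]; exact (hw01 t ht).2
  have hw2le : (∫ t in Set.Ioo (0:ℝ) 1, (t ^ a) ^ 2) ≤ 1 := by
    have h1 : (∫ t in Set.Ioo (0:ℝ) 1, (t ^ a) ^ 2) ≤ ∫ t in Set.Ioo (0:ℝ) 1, (1:ℝ) := by
      refine setIntegral_mono_on hw2 (integrableOn_const (by simp)) measurableSet_Ioo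
        fun t ht => ?_
      have := hw01 t ht
      nlinarith
    have h2 : (∫ t in Set.Ioo (0:ℝ) 1, (1:ℝ)) = 1 := by simp
    linarith
  -- integrability of the two products
  have hgw : IntegrableOn (fun t => gramRay t * t ^ a) (Set.Ioo (0:ℝ) 1) := by
    refine Integrable.mono' (integrableOn_const (C := (5:ℝ)) (by simp))
      ((continuous_gramRay.measurable.mul hwm).aestronglyMeasurable) ?_
    filter_upwards [ae_restrict_mem measurableSet_Ioo] with t ht
    rw [Real.norm_eq_abs, abs_mul, abs_of_nonneg (hw01 t ht).1]
    calc |gramRay t| * t ^ a ≤ 5 * 1 :=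
          mul_le_mul (abs_gramRay_le (Set.Ioo_subset_Icc_self ht)) (hw01 t ht).2 (hw01 t ht).1
            (by norm_num)
      _ = 5 := by norm_num
  have hDw : IntegrableOn (fun t => coprofileOp D t * t ^ a) (Set.Ioo (0:ℝ) 1) := by
    have hsum2 : IntegrableOn (fun t => coprofileOp D t ^ 2 + (t ^ a) ^ 2) (Set.Ioo (0:ℝ) 1) :=
      hADint.add hw2
    refine Integrable.mono' hsum2 (((measurable_coprofileOp hDm).mul hwm).aestronglyMeasurable) ?_
    filter_upwards with t
    rw [Real.norm_eq_abs, abs_mul]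
    nlinarith [sq_nonneg (|coprofileOp D t| - |t ^ a|), sq_abs (coprofileOp D t), sq_abs (t ^ a),
      mul_nonneg (abs_nonneg (coprofileOp D t)) (abs_nonneg (t ^ a))]
  -- split the moment of `A q`
  have hsum : (∫ t in Set.Ioo (0:ℝ) 1, coprofileOp (fun u => q.eval u) t * t ^ a)
      = (∫ t in Set.Ioo (0:ℝ) 1, gramRay t * t ^ a)
        + ∫ t in Set.Ioo (0:ℝ) 1, coprofileOp D t * t ^ a := by
    rw [← integral_add hgw hDw]
    refine setIntegral_congr_fun measurableSet_Ioo fun t ht => ?_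
    rw [hsplit t ht, add_mul]
  rw [hsum, hr, zero_add] at hmom
  -- Cauchy–Schwarz on the defect
  have hCS := abs_setIntegral_mul_le_sqrt (measurable_coprofileOp hDm) hwm hADint hw2
  have hs1 : Real.sqrt (∫ t in Set.Ioo (0:ℝ) 1, coprofileOp D t ^ 2)
      ≤ 3 * Real.sqrt (∫ u in Set.Ioo (0:ℝ) 1, D u ^ 2) := by
    rw [show (3:ℝ) = Real.sqrt 9 by rw [show (9:ℝ) = 3 ^ 2 by norm_num, Real.sqrt_sq (by norm_num)],
      ← Real.sqrt_mul (by norm_num)]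
    exact Real.sqrt_le_sqrt hAD9
  have hs2 : Real.sqrt (∫ t in Set.Ioo (0:ℝ) 1, (t ^ a) ^ 2) ≤ 1 := by
    have h := Real.sqrt_le_sqrt hw2le
    rwa [Real.sqrt_one] at h
  have h0 : 0 ≤ Real.sqrt (∫ u in Set.Ioo (0:ℝ) 1, D u ^ 2) := Real.sqrt_nonneg _
  rw [← abs_mul, ← hmom]
  calc |∫ t in Set.Ioo (0:ℝ) 1, coprofileOp D t * t ^ a|
      ≤ Real.sqrt (∫ t in Set.Ioo (0:ℝ) 1, coprofileOp D t ^ 2)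
          * Real.sqrt (∫ t in Set.Ioo (0:ℝ) 1, (t ^ a) ^ 2) := hCS
    _ ≤ (3 * Real.sqrt (∫ u in Set.Ioo (0:ℝ) 1, D u ^ 2)) * 1 :=
        mul_le_mul hs1 hs2 (Real.sqrt_nonneg _) (by positivity)
    _ = 3 * Real.sqrt (∫ u in Set.Ioo (0:ℝ) 1, (q.eval u - moebiusRay u) ^ 2) := by
        rw [mul_one]

/-- The two moment defects of E1: `|∫₀¹ q·u| ≤ K √(∫(q−φ*)²)` and `|∫₀¹ q·u^{1/2}| ≤ K √(∫(q−φ*)²)`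
with the explicit constant `K = 3/|ζ(3)| + 3/|ζ(5/2)|` (only its finiteness matters). [folklore] -/
theorem moment_defects (q : ℝ[X]) :
    |∫ u in (0:ℝ)..1, q.eval u * u|
        ≤ (3 / |(riemannZeta (((1:ℝ) : ℂ) + 2)).re|)
          * Real.sqrt (∫ u in Set.Ioo (0:ℝ) 1, (q.eval u - moebiusRay u) ^ 2) ∧
      |∫ u in (0:ℝ)..1, q.eval u * u ^ (1 / 2 : ℝ)|
        ≤ (3 / |(riemannZeta (((1 / 2 : ℝ) : ℂ) + 2)).re|)
          * Real.sqrt (∫ u in Set.Ioo (0:ℝ) 1, (q.eval u - moebiusRay u) ^ 2) := by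
  have hz1 : 0 < |(riemannZeta (((1:ℝ) : ℂ) + 2)).re| :=
    abs_pos.mpr (riemannZeta_re_ne_zero zero_le_one)
  have hzh : 0 < |(riemannZeta (((1 / 2 : ℝ) : ℂ) + 2)).re| :=
    abs_pos.mpr (riemannZeta_re_ne_zero (by norm_num))
  have hr1 : ∫ t in Set.Ioo (0:ℝ) 1, gramRay t * t ^ (1:ℝ) = 0 := by
    simp_rw [Real.rpow_one]; exact setIntegral_gramRay_mul_id
  have hrh : ∫ t in Set.Ioo (0:ℝ) 1, gramRay t * t ^ (1 / 2 : ℝ) = 0 := by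
    simp_rw [← Real.sqrt_eq_rpow]; exact setIntegral_gramRay_mul_sqrt
  have h1 := abs_moment_le_of_gramRay_orth q zero_le_one hr1
  have hh := abs_moment_le_of_gramRay_orth q (by norm_num : (0:ℝ) ≤ 1 / 2) hrh
  have e1 : (∫ u in (0:ℝ)..1, q.eval u * u ^ (1:ℝ)) = ∫ u in (0:ℝ)..1, q.eval u * u := by
    simp_rw [Real.rpow_one]
  rw [e1] at h1
  constructor
  · rw [div_mul_eq_mul_div, le_div_iff₀ hz1, mul_comm]
    exact h1
  · rw [div_mul_eq_mul_div, le_div_iff₀ hzh, mul_comm]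
    exact hh

/-! ### §3 `L²`-approximation of `φ*` by polynomials -/

/-- `φ*` is `L²(0,1)`-approximable by polynomials: for `η > 0` there is a polynomial `q` with
`∫₀¹ (q − φ*)² ≤ η` (bounded continuous `L²`-approximation + Weierstrass). [folklore] -/
theorem exists_polynomial_sq_near_moebiusRay {η : ℝ} (hη : 0 < η) :
    ∃ q : ℝ[X], (∫ u in Set.Ioo (0:ℝ) 1, (q.eval u - moebiusRay u) ^ 2) ≤ η := by
  set μ : Measure ℝ := volume.restrict (Set.Ioo (0:ℝ) 1) with hμ
  haveI : IsFiniteMeasure μ := isFiniteMeasure_restrict_Ioo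
  -- (i) a bounded continuous `g` with `∫ (φ* − g)² ≤ η/4`
  have hmem : MemLp moebiusRay (ENNReal.ofReal 2) μ := by
    rw [show ENNReal.ofReal 2 = 2 by norm_num]; exact memLp_two_moebiusRay
  obtain ⟨g, hg, hgmem⟩ := hmem.exists_boundedContinuous_integral_rpow_sub_le zero_lt_two
    (ε := η / 4) (by positivity)
  have hg' : (∫ u in Set.Ioo (0:ℝ) 1, (moebiusRay u - g u) ^ 2) ≤ η / 4 := by
    have e : (∫ u, ‖moebiusRay u - g u‖ ^ (2:ℝ) ∂μ)
        = ∫ u in Set.Ioo (0:ℝ) 1, (moebiusRay u - g u) ^ 2 :=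
      integral_congr_ae (ae_of_all _ fun u => by
        simp only [Real.norm_eq_abs, Real.rpow_two, sq_abs])
    rw [← e]; exact hg
  have hgm : Measurable (g : ℝ → ℝ) := g.continuous.measurable
  have hgφ2 : IntegrableOn (fun u => (moebiusRay u - g u) ^ 2) (Set.Ioo (0:ℝ) 1) := by
    have h2 : MemLp (fun u => moebiusRay u - g u) 2 μ := by
      have := hmem.sub hgmem
      rw [show ENNReal.ofReal 2 = 2 by norm_num] at this
      exact this
    exact (memLp_two_iff_integrable_sq
      (measurable_moebiusRay.sub hgm).aestronglyMeasurable).mp h2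
  -- (ii) Weierstrass: a polynomial `q` with `|q − g| < √(η/4)` on `[0,1]`
  obtain ⟨q, hq⟩ := exists_polynomial_near_of_continuousOn 0 1 g g.continuous.continuousOn
    (Real.sqrt (η / 4)) (Real.sqrt_pos.mpr (by positivity))
  refine ⟨q, ?_⟩
  have hqg : ∀ u ∈ Set.Ioo (0:ℝ) 1, (q.eval u - g u) ^ 2 ≤ η / 4 := by
    intro u hu
    have h := (hq u (Set.Ioo_subset_Icc_self hu)).le
    calc (q.eval u - g u) ^ 2 = |q.eval u - g u| ^ 2 := (sq_abs _).symm
      _ ≤ (Real.sqrt (η / 4)) ^ 2 := pow_le_pow_left₀ (abs_nonneg _) h 2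
      _ = η / 4 := Real.sq_sqrt (by positivity)
  have hqg2 : IntegrableOn (fun u => (q.eval u - g u) ^ 2) (Set.Ioo (0:ℝ) 1) := by
    have hb : ∀ u ∈ Set.Ioo (0:ℝ) 1, |q.eval u - g u| ≤ Real.sqrt (η / 4) := fun u hu =>
      (hq u (Set.Ioo_subset_Icc_self hu)).le
    have h := integrableOn_sq_of_bound (q.continuous.measurable.sub hgm) hb
    exact h
  -- (iii) combine: `(q − φ*)² ≤ 2(q − g)² + 2(g − φ*)²`
  have hmaj : IntegrableOn (fun u => 2 * (q.eval u - g u) ^ 2 + 2 * (moebiusRay u - g u) ^ 2)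
      (Set.Ioo (0:ℝ) 1) := (hqg2.const_mul 2).add (hgφ2.const_mul 2)
  have hle : (∫ u in Set.Ioo (0:ℝ) 1, (q.eval u - moebiusRay u) ^ 2)
      ≤ ∫ u in Set.Ioo (0:ℝ) 1, (2 * (q.eval u - g u) ^ 2 + 2 * (moebiusRay u - g u) ^ 2) := by
    refine integral_mono_of_nonneg (ae_of_all _ fun u => sq_nonneg _) hmaj
      (ae_of_all _ fun u => ?_)
    -- `(x − z)² ≤ 2(x − y)² + 2(z − y)²`
    nlinarith [sq_nonneg ((q.eval u - g u) + (moebiusRay u - g u))]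
  have hval : (∫ u in Set.Ioo (0:ℝ) 1, (2 * (q.eval u - g u) ^ 2 + 2 * (moebiusRay u - g u) ^ 2))
      ≤ η := by
    rw [integral_add (hqg2.const_mul 2) (hgφ2.const_mul 2), integral_const_mul,
      integral_const_mul]
    have h1 : (∫ u in Set.Ioo (0:ℝ) 1, (q.eval u - g u) ^ 2) ≤ η / 4 := by
      have h2 : (∫ u in Set.Ioo (0:ℝ) 1, (q.eval u - g u) ^ 2) ≤ ∫ u in Set.Ioo (0:ℝ) 1, η / 4 :=
        setIntegral_mono_on hqg2 (integrableOn_const (by simp)) measurableSet_Ioo hqg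
      have h3 : (∫ u in Set.Ioo (0:ℝ) 1, η / 4) = η / 4 := by simp
      linarith
    linarith
  exact hle.trans hval

/-! ### §4 Correction in `span{1, u}` and the main result -/

/-- Moments of the correction `c₀ + c₁u` against `u`: `∫₀¹ (c₀ + c₁u)u du = c₀/2 + c₁/3`.
[folklore] -/
theorem integral_correction_mul_id (c₀ c₁ : ℝ) :
    ∫ u in (0:ℝ)..1, (c₀ + c₁ * u) * u = c₀ / 2 + c₁ / 3 := by
  have h := integral_rpow_combination 0 0 c₀ 0 c₁
  have e : (fun u : ℝ => (c₀ + c₁ * u) * u)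
      = fun t : ℝ => 0 + 0 * t ^ (1 / 2 : ℝ) + c₀ * t + 0 * t ^ (3 / 2 : ℝ) + c₁ * t ^ 2 := by
    funext t; ring
  rw [e, h]; ring

/-- Moments of the correction against `u^{1/2}`: `∫₀¹ (c₀ + c₁u)u^{1/2} du = 2c₀/3 + 2c₁/5`.
[folklore] -/
theorem integral_correction_mul_sqrt (c₀ c₁ : ℝ) :
    ∫ u in (0:ℝ)..1, (c₀ + c₁ * u) * u ^ (1 / 2 : ℝ) = 2 / 3 * c₀ + 2 / 5 * c₁ := by
  have h := integral_rpow_combination 0 c₀ 0 c₁ 0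
  have e : ∫ u in (0:ℝ)..1, (c₀ + c₁ * u) * u ^ (1 / 2 : ℝ)
      = ∫ t in (0:ℝ)..1, 0 + c₀ * t ^ (1 / 2 : ℝ) + 0 * t + c₁ * t ^ (3 / 2 : ℝ) + 0 * t ^ 2 := by
    refine intervalIntegral.integral_congr fun t ht => ?_
    rw [Set.uIcc_of_le zero_le_one] at ht
    have h32 : t ^ (3 / 2 : ℝ) = t * t ^ (1 / 2 : ℝ) := by
      rw [show (3 / 2 : ℝ) = 1 + 1 / 2 by norm_num, Real.rpow_add' ht.1 (by norm_num),
        Real.rpow_one]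
    simp only [h32]
    ring
  rw [e, h]; ring

/-- **Piece (b) of crux E1** (`NearExtremalGenerators`, stmt-RiemannHypothesis-22262): for every
`δ > 0` there is a polynomial `p` with `∫₀¹ (p − φ*)² ≤ δ` and the two admissibility moments
`∫₀¹ p(u)u du = 0`, `∫₀¹ p(u)u^{1/2} du = 0`. [folklore] -/
theorem exists_polynomial_near_moebiusRay :
    ∀ δ : ℝ, 0 < δ → ∃ p : Polynomial ℝ,
      (∫ u in Set.Ioo (0:ℝ) 1, (p.eval u - moebiusRay u) ^ 2) ≤ δ ∧
        (∫ u in (0:ℝ)..1, p.eval u * u) = 0 ∧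
          (∫ u in (0:ℝ)..1, p.eval u * u ^ (1 / 2 : ℝ)) = 0 := by
  intro δ hδ
  -- constants
  set K₁ : ℝ := 3 / |(riemannZeta (((1:ℝ) : ℂ) + 2)).re| with hK₁
  set Kh : ℝ := 3 / |(riemannZeta (((1 / 2 : ℝ) : ℂ) + 2)).re| with hKh
  have hK₁0 : 0 ≤ K₁ := by rw [hK₁]; positivity
  have hKh0 : 0 ≤ Kh := by rw [hKh]; positivity
  set L : ℝ := 48 * K₁ + 38 * Kh with hL
  have hL0 : 0 ≤ L := by rw [hL]; positivity
  set η : ℝ := δ / (2 + 2 * L ^ 2) with hη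
  have hden : 0 < 2 + 2 * L ^ 2 := by positivity
  have hη0 : 0 < η := by rw [hη]; positivity
  obtain ⟨q, hq⟩ := exists_polynomial_sq_near_moebiusRay hη0
  -- the raw moments and their defects
  set m₁ : ℝ := ∫ u in (0:ℝ)..1, q.eval u * u with hm₁
  set mh : ℝ := ∫ u in (0:ℝ)..1, q.eval u * u ^ (1 / 2 : ℝ) with hmh
  set s : ℝ := Real.sqrt (∫ u in Set.Ioo (0:ℝ) 1, (q.eval u - moebiusRay u) ^ 2) with hs
  have hs0 : 0 ≤ s := Real.sqrt_nonneg _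
  have hI0 : 0 ≤ ∫ u in Set.Ioo (0:ℝ) 1, (q.eval u - moebiusRay u) ^ 2 :=
    setIntegral_nonneg measurableSet_Ioo fun u _ => sq_nonneg _
  have hs2 : s ^ 2 = ∫ u in Set.Ioo (0:ℝ) 1, (q.eval u - moebiusRay u) ^ 2 := by
    rw [hs, Real.sq_sqrt hI0]
  obtain ⟨hd1, hdh⟩ := moment_defects q
  have hm₁le : |m₁| ≤ K₁ * s := hd1
  have hmhle : |mh| ≤ Kh * s := hdh
  -- the correction coefficients (inverse of the Gram matrix [[1/2,1/3],[2/3,2/5]], det 1/45)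
  set c₁ : ℝ := 30 * m₁ - 45 / 2 * mh with hc₁
  set c₀ : ℝ := -18 * m₁ + 15 * mh with hc₀
  have hsol1 : c₀ / 2 + c₁ / 3 = m₁ := by rw [hc₀, hc₁]; ring
  have hsolh : 2 / 3 * c₀ + 2 / 5 * c₁ = mh := by rw [hc₀, hc₁]; ring
  have hcsum : |c₀| + |c₁| ≤ L * s := by
    have h1 : |c₀| ≤ 18 * |m₁| + 15 * |mh| := by
      rw [hc₀]
      calc |-18 * m₁ + 15 * mh| ≤ |-18 * m₁| + |15 * mh| := abs_add_le _ _
        _ = 18 * |m₁| + 15 * |mh| := by rw [abs_mul, abs_mul]; norm_num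
    have h2 : |c₁| ≤ 30 * |m₁| + 45 / 2 * |mh| := by
      rw [hc₁]
      calc |30 * m₁ - 45 / 2 * mh| ≤ |30 * m₁| + |45 / 2 * mh| := abs_sub _ _
        _ = 30 * |m₁| + 45 / 2 * |mh| := by rw [abs_mul, abs_mul]; norm_num
    rw [hL]
    nlinarith [hm₁le, hmhle, abs_nonneg m₁, abs_nonneg mh]
  -- the corrected polynomial
  refine ⟨q - Polynomial.C c₀ - Polynomial.C c₁ * Polynomial.X, ?_, ?_, ?_⟩
  · -- `L²` distance
    have hev : ∀ u : ℝ, (q - Polynomial.C c₀ - Polynomial.C c₁ * Polynomial.X).eval u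
        = q.eval u - (c₀ + c₁ * u) := by
      intro u; simp [Polynomial.eval_sub, Polynomial.eval_mul]; ring
    simp_rw [hev]
    have hpt : ∀ u ∈ Set.Ioo (0:ℝ) 1,
        (q.eval u - (c₀ + c₁ * u) - moebiusRay u) ^ 2
          ≤ 2 * (q.eval u - moebiusRay u) ^ 2 + 2 * (L * s) ^ 2 := by
      intro u hu
      have h1 : (q.eval u - (c₀ + c₁ * u) - moebiusRay u) ^ 2
          ≤ 2 * (q.eval u - moebiusRay u) ^ 2 + 2 * (c₀ + c₁ * u) ^ 2 := by
        nlinarith [sq_nonneg ((q.eval u - moebiusRay u) + (c₀ + c₁ * u))]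
      have h2 : |c₀ + c₁ * u| ≤ |c₀| + |c₁| := by
        calc |c₀ + c₁ * u| ≤ |c₀| + |c₁ * u| := abs_add_le _ _
          _ ≤ |c₀| + |c₁| := by
              rw [abs_mul]
              have : |u| ≤ 1 := abs_le.mpr ⟨by linarith [hu.1], hu.2.le⟩
              nlinarith [abs_nonneg c₁]
      have h3 : (c₀ + c₁ * u) ^ 2 ≤ (L * s) ^ 2 := by
        calc (c₀ + c₁ * u) ^ 2 = |c₀ + c₁ * u| ^ 2 := (sq_abs _).symm
          _ ≤ (|c₀| + |c₁|) ^ 2 := pow_le_pow_left₀ (abs_nonneg _) h2 2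
          _ ≤ (L * s) ^ 2 := pow_le_pow_left₀ (by positivity) hcsum 2
      linarith
    have hq2 := integrableOn_sq_polynomial_sub_moebiusRay q
    have hmaj : IntegrableOn (fun u => 2 * (q.eval u - moebiusRay u) ^ 2 + 2 * (L * s) ^ 2)
        (Set.Ioo (0:ℝ) 1) := (hq2.const_mul 2).add (integrableOn_const (by simp))
    have hle : (∫ u in Set.Ioo (0:ℝ) 1, (q.eval u - (c₀ + c₁ * u) - moebiusRay u) ^ 2)
        ≤ ∫ u in Set.Ioo (0:ℝ) 1, (2 * (q.eval u - moebiusRay u) ^ 2 + 2 * (L * s) ^ 2) :=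
      integral_mono_of_nonneg (ae_of_all _ fun u => sq_nonneg _) hmaj
        ((ae_restrict_mem measurableSet_Ioo).mono fun u hu => hpt u hu)
    have hval : (∫ u in Set.Ioo (0:ℝ) 1, (2 * (q.eval u - moebiusRay u) ^ 2 + 2 * (L * s) ^ 2))
        = 2 * s ^ 2 + 2 * (L * s) ^ 2 := by
      rw [integral_add (hq2.const_mul 2) (integrableOn_const (by simp)), integral_const_mul, hs2]
      simp
    rw [hval] at hle
    have hs2le : s ^ 2 ≤ η := by rw [hs2]; exact hq
    calc (∫ u in Set.Ioo (0:ℝ) 1, (q.eval u - (c₀ + c₁ * u) - moebiusRay u) ^ 2)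
        ≤ 2 * s ^ 2 + 2 * (L * s) ^ 2 := hle
      _ = (2 + 2 * L ^ 2) * s ^ 2 := by ring
      _ ≤ (2 + 2 * L ^ 2) * η := mul_le_mul_of_nonneg_left hs2le hden.le
      _ = δ := by rw [hη]; field_simp
  · -- moment against `u`
    have hev : ∀ u : ℝ, (q - Polynomial.C c₀ - Polynomial.C c₁ * Polynomial.X).eval u * u
        = q.eval u * u - (c₀ + c₁ * u) * u := by
      intro u; simp [Polynomial.eval_sub, Polynomial.eval_mul]; ring
    simp_rw [hev]
    have hi1 : IntervalIntegrable (fun u => q.eval u * u) volume 0 1 :=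
      (q.continuous.mul continuous_id).intervalIntegrable _ _
    have hi2 : IntervalIntegrable (fun u => (c₀ + c₁ * u) * u) volume 0 1 := by
      apply Continuous.intervalIntegrable; fun_prop
    rw [intervalIntegral.integral_sub hi1 hi2, integral_correction_mul_id, ← hm₁, ← hsol1]
    ring
  · -- moment against `u^{1/2}`
    have hev : ∀ u : ℝ,
        (q - Polynomial.C c₀ - Polynomial.C c₁ * Polynomial.X).eval u * u ^ (1 / 2 : ℝ)
          = q.eval u * u ^ (1 / 2 : ℝ) - (c₀ + c₁ * u) * u ^ (1 / 2 : ℝ) := by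
      intro u; simp [Polynomial.eval_sub, Polynomial.eval_mul]; ring
    simp_rw [hev]
    have hc : Continuous fun u : ℝ => u ^ (1 / 2 : ℝ) :=
      Real.continuous_rpow_const (by norm_num)
    have hi1 : IntervalIntegrable (fun u => q.eval u * u ^ (1 / 2 : ℝ)) volume 0 1 :=
      (q.continuous.mul hc).intervalIntegrable _ _
    have hi2 : IntervalIntegrable (fun u => (c₀ + c₁ * u) * u ^ (1 / 2 : ℝ)) volume 0 1 :=
      ((continuous_const.add (continuous_const.mul continuous_id)).mul hc).intervalIntegrable _ _
    rw [intervalIntegral.integral_sub hi1 hi2, integral_correction_mul_sqrt, ← hmh, ← hsolh]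
    ring

end Summit.RiemannHypothesis.RiemannHypothesis.Theorems.ScrewLemmaKExtremalRay

end
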